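import Summits.ResolutionOfSingularities.ResolutionOfSingularities.Theorems.PurelyInseparableDim4InScopeWinCertLeaves
import HarnessLib

/-!
# F4-C ‖ K over `𝔽₂`, BEYOND the D ≤ 4 band — file 73 (part 1 of 3 for this root group): 1 RUN 4b root with `degmax = 6` that eng-w5's engine
# left «OPEN:budget» in j313332 is IN-SCOPE ESCAPABLE (kernel); cell `res-dim4-pi`, seat res-dim4-p-13 (g3)

[OURS · counted 0 · census value] Nothing here is a statement about resolution of singularities; F4-C
(`TerminatesInScope 2 2`) is neither proved nor refuted here.  RUN 4b (eng-w5 j313332, the F4-C instrument: A = every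
permissible coordinate centre, B = every `𝔽₂`-rational equimultiple chart point) left 1,002 of its roots with
`degmax = 6` undecided within its budget (1,001 «OPEN:budget», 1 «TRAP-FOUND» with the trap out of scope).  The
lineage's F-keyed search (`tools/band40f.py`, res-dim4-p-13 g2; blindness oracle `tools/wit2.py`: monomial / rational /
algebraic-branch (plane cubics) witnesses, all landed kernel grammars; 12 cpu-s per root on 4 cores) wins 623 of them
over `𝔽₂`-rational play; 527 are BLIND at the root (`…BandWin40/41`); this file certifies 1 of the 96 deeper ones —
root S1a-0bbb8f2574 (least A-escape depth 4 over 𝔽₂-rational play) — as BLOCK certificates: the union of the roots' strategy DAGs (74 rows) is laid out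
root by root in parent-first order (small sub-trees first) and cut into segments of ≤ 12 rows (`blk73…`; the block docstrings and
`rootBlocks73` say which row of which block is each root); every `decide +kernel` sees
≤ 12 rows and a leaf list made of the algebraic leaves and the rows of the few later segments it cites (`certStates`,
`leaves_of_certs` — the citation pattern of BandWin31–39); segments are written children-first.  So these
engine-undecided `degmax = 6` roots hide NO `𝔽₂`-rational kill of F4-C(2,2): player A escapes from each (rider (ii):
`𝔽₂`-rational replies only; nothing about ∀K).  OURS; counted 0.  Supports stmt-ResolutionOfSingularities-16155 (helper).
bears_on: LADDER-RESOLUTION:D157-DOOR2 (res-dim4-pi · F4-C instrument ‖ K · beyond the band · degmax 6).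
-/

set_option linter.dupNamespace false -- mandated namespace of this single-conjunct summit

noncomputable section

namespace Summit.ResolutionOfSingularities.ResolutionOfSingularities.Theorems.PIDim4

namespace InScopeWinCert

open StepKit ScopeBlind

/-- Block `blk73g`: 2 rows (a contiguous parent-first segment of the strategy DAG; children are later rows, rows of the cited blocks, or algebraic leaves). [folklore] -/
def blk73g : ICert (ZMod 2) := [
  (⟨[(![0, 0, 1, 1], 1), (![0, 0, 2, 1], 1), (![0, 5, 1, 2], 1), (![0, 5, 3, 2], 1), (![1, 1, 3, 0], 1)], ![0, 0, 0, 0], {3}⟩, {2, 3}, none),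
  (⟨[(![0, 0, 1, 1], 1), (![0, 0, 2, 1], 1), (![0, 5, 2, 2], 1), (![0, 5, 3, 2], 1), (![1, 1, 0, 0], 1), (![1, 1, 1, 0], 1), (![1, 1, 2, 0], 1), (![1, 1, 3, 0], 1)], ![0, 0, 0, 0], {2, 3}⟩, {0, 1, 2, 3}, none)
  ]

/-- Block `blk73g` cites no leaves. [folklore] -/
def blk73gL : List (SData 4 (ZMod 2)) := []

/-- Vacuous: block `blk73g` has no leaves. -/
theorem blk73gL_ok : ∀ s ∈ blk73gL, InScopeStateWins 2 s.toState := fun _ hs => absurd hs List.not_mem_nil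

set_option maxRecDepth 8192 in -- long certificate literal
set_option maxHeartbeats 1600000 in -- `decide +kernel` defeq check of a strategy block
/-- Block `blk73g` checks against its leaves (kernel). -/
theorem iwinCertB_blk73g : iwinCertBL 2 blk73gL blk73g = true := by decide +kernel

/-- Every row state of block `blk73g` is in-scope escapable over `𝔽₂`. [folklore] -/
theorem inScopeStateWins_of_mem_blk73g : ∀ r ∈ blk73g, InScopeStateWins 2 r.1.toState :=
  inScopeStateWins_of_iwinCertBL blk73gL_ok iwinCertB_blk73g

end InScopeWinCert

end Summit.ResolutionOfSingularities.ResolutionOfSingularities.Theorems.PIDim4
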